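/-
Copyright: the b2b-balaban cell (near-miss cell 7), T⁴-continuum CRUX team (coordinator ruling e34b3e0c item (2)),
seat t4-ne7b-formalise-leaf-06 (gen 28). Released under the licence of the surrounding project.
-/
import Summits.QuantumFields.BalabanUV.T4Continuum.Spine.NE7b.SineCurvatureMaximumPrinciple
import Summits.QuantumFields.BalabanUV.T4Continuum.Spine.NE7b.LinkMinimiserEL

/-!
# PH-k for one-link minimisers: the approximate maximum principle for the sine-curvature of a Wilson-action
# configuration minimal in every free link (route NE7b R-H, `t4/ROUTES-NE7b.md` v5 §2 PH-k (β) «a configuration that is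
# CRITICAL IN EVERY FREE LINK (a fortiori the minimiser `U_Ω(e)`)» + (β₄) + (γ))

Cell `pub-balaban`, sub-cell `t4`, spine estimate NE7b (node U5c), candidate route R-H, lemma PH-k. This file is GLUE
between two landed kernel pieces, BY NAME:
* `LinkMinimiserEL.covDiv_eq_zero_of_isLocalMin_actionThrough` (seat `t4-ne7b-formalise-leaf-05` gen 26, p255095): a
  link variable that is a LOCAL MINIMISER, on the group `S³` of unit quaternions, of the Wilson action of the `2(d−1)`
  plaquettes through the link (the other links frozen) satisfies the lattice Yang–Mills equation `covDiv U x i = 0`;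
* `SineCurvatureMaximumPrinciple.sineCurvature_le_layerMax` (this lineage, gen 28): PH-k assembled from (β₄)
  (`CovariantMeanValueInequality.meanValue_inequality`, p254430) and (γ) (`LatticeSubsolutionBarrier`, p252732).

RESULT **`sineCurvature_le_layerMax_of_isLocalMin`**: for a unit-quaternion configuration `U` on `ℤ^d` (`d ≥ 1`),
directions `i ≠ j` and a finite set `I` of base points such that, for every `x ∈ I`, EACH OF THE FOUR LINKS of the
plaquette `(x; i, j)` is a local one-link minimiser of the Wilson action and the faces of the cubes above∕below the
plaquette have `Re ≥ 0` and sine-curvature `≤ m ≤ ½`: `‖E_{ij}(x₀)‖ ≤ M + (232(d−2)m²∕2d)·D²` for `x₀ ∈ I`, where `M`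
bounds `‖E_{ij}‖` on `layer I` and `D²` the squared distance from `x₀` to `layer I`. The GLOBAL one-link form
(`…_of_forall_actionThrough_le`) is recorded too. This is v5 PH-k's statement «for the minimiser» up to the two inputs
it names itself: the a-priori ENVELOPE `m` ((δ)∕PH-k″) and the look-in certification of `layer I`.

HONEST FRAMING. Law-free kernel facts about ONE configuration; nothing of (MP<L²)'s envelope∕window, nothing of
[Bałaban 1983–89] asserted or cited; the `specialUnitaryGroup (Fin 2) ℂ ≃` unit-quaternion bridge is NOT formalised.
NE7b (`T4WeightBudget.RelWeightBound`) NOT PRINTED, NOT PROVED; spine PROVED 0∕9; rung (B)+1 on a FINITE torus T⁴ — NOT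
infinite volume, NOT the mass gap, NOT Clay. HONEST DEPENDENCY: continuum YM on T⁴ ⇐ BetaPertH ∧ nine spine estimates
(0/9 proved); BetaPertH ⇐ (D1) ∧ (D4) ∧ CAP+tail; G-an2-4 gates asym, D1 and NE2/3/4. POLICY: crux-route work under
`Spine/NE7b/` (FREEZE (0) respected); 0 definitions, no `Prop` fact, no `[cite:]` fact.
-/

set_option autoImplicit false

namespace Summit.QuantumFields.BalabanUV.T4Continuum.NE7b.MinimiserMaximumPrinciple

noncomputable section

open scoped Quaternion
open Literature.MathematicalPhysics.QuantumFieldTheory (ZdEdge ZdGaugeConfig)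
open Literature.Probability.LatticeModels (Site)
open Summit.QuantumFields.BalabanUV.T4Continuum.NE7b.AbelianCurvatureMaximumPrinciple (layer)
open Summit.QuantumFields.BalabanUV.T4Continuum.NE7b.LatticeSubsolutionBarrier (distSq)
open Summit.QuantumFields.BalabanUV.T4Continuum.NE7b.CovariantDivergenceEL (curv covDiv)
open Summit.QuantumFields.BalabanUV.T4Continuum.NE7b.CovariantMeanValueInequality (cubeFaces)
open Summit.QuantumFields.BalabanUV.T4Continuum.NE7b.LinkMinimiserEL (actionThrough
  covDiv_eq_zero_of_isLocalMin_actionThrough covDiv_eq_zero_of_forall_actionThrough_le)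
open Summit.QuantumFields.BalabanUV.T4Continuum.NE7b.SineCurvatureMaximumPrinciple (sineCurvature_le_layerMax)

variable {d : ℕ}

/-- **PH-k FOR LOCAL ONE-LINK MINIMISERS.** Unit-quaternion configuration `U` on `ℤ^d` (`d ≥ 1`), directions `i ≠ j`,
finite `I`; for every `x ∈ I`: the four links `(x,i)`, `(x,j)`, `(x+e_j,i)`, `(x+e_i,j)` of the plaquette `(x; i, j)`
are LOCAL MINIMISERS (on `S³`, other links frozen) of the Wilson action of the plaquettes through them, and the faces
of the `2(d−2)` cubes above∕below the plaquette have `Re ≥ 0` and sine-curvature `≤ m ≤ ½`. Then for `x₀ ∈ I`: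
`‖E_{ij}(x₀)‖ ≤ M + (232(d−2)m² ∕ 2d)·D²`, `M` a bound for `‖E_{ij}‖` on `layer I`, `D²` a bound for the squared lattice
distance from `x₀` to the points of `layer I`. -/
theorem sineCurvature_le_layerMax_of_isLocalMin (hd : 0 < d) (U : ZdGaugeConfig d (Metric.sphere (0 : ℍ) 1))
    (i j : Fin d) (hij : i ≠ j) (I : Finset (Site d)) {m M D2 : ℝ} (hm : 0 ≤ m) (hm2 : m ≤ 1 / 2)
    (hre : ∀ x ∈ I, ∀ k : Fin d, k ≠ i → k ≠ j →
      ∀ q ∈ cubeFaces U x i j k ++ cubeFaces U (x - Pi.single k 1) i j k, 0 ≤ (q : ℍ).re)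
    (him : ∀ x ∈ I, ∀ k : Fin d, k ≠ i → k ≠ j →
      ∀ q ∈ cubeFaces U x i j k ++ cubeFaces U (x - Pi.single k 1) i j k, ‖(q : ℍ).im‖ ≤ m)
    (hmin : ∀ x ∈ I,
      IsLocalMin (fun V : (Metric.sphere (0 : ℍ) 1) => actionThrough (Function.update U (x, i) V) x i) (U (x, i)) ∧
      IsLocalMin (fun V : (Metric.sphere (0 : ℍ) 1) => actionThrough (Function.update U (x, j) V) x j) (U (x, j)) ∧
      IsLocalMin (fun V : (Metric.sphere (0 : ℍ) 1) =>
        actionThrough (Function.update U (x + Pi.single j 1, i) V) (x + Pi.single j 1) i) (U (x + Pi.single j 1, i)) ∧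
      IsLocalMin (fun V : (Metric.sphere (0 : ℍ) 1) =>
        actionThrough (Function.update U (x + Pi.single i 1, j) V) (x + Pi.single i 1) j) (U (x + Pi.single i 1, j)))
    (hM : ∀ y ∈ layer I, ‖curv U y i j‖ ≤ M) {x₀ : Site d} (hx₀ : x₀ ∈ I)
    (hD : ∀ y ∈ layer I, distSq x₀ y ≤ D2) :
    ‖curv U x₀ i j‖ ≤ M + (232 * ((d : ℝ) - 2) * m ^ 2) / (2 * d) * D2 := by
  refine sineCurvature_le_layerMax hd U i j hij I hm hm2 hre him (fun x hx => ?_) hM hx₀ hD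
  obtain ⟨h1, h2, h3, h4⟩ := hmin x hx
  exact ⟨covDiv_eq_zero_of_isLocalMin_actionThrough U x i h1, covDiv_eq_zero_of_isLocalMin_actionThrough U x j h2,
    covDiv_eq_zero_of_isLocalMin_actionThrough U _ i h3, covDiv_eq_zero_of_isLocalMin_actionThrough U _ j h4⟩

/-- **PH-k FOR GLOBAL ONE-LINK MINIMISERS** (the same with «no `V ∈ S³` lowers the action through the link» at the four
links of every plaquette of `I`). -/
theorem sineCurvature_le_layerMax_of_forall_actionThrough_le (hd : 0 < d)
    (U : ZdGaugeConfig d (Metric.sphere (0 : ℍ) 1)) (i j : Fin d) (hij : i ≠ j) (I : Finset (Site d)) {m M D2 : ℝ}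
    (hm : 0 ≤ m) (hm2 : m ≤ 1 / 2)
    (hre : ∀ x ∈ I, ∀ k : Fin d, k ≠ i → k ≠ j →
      ∀ q ∈ cubeFaces U x i j k ++ cubeFaces U (x - Pi.single k 1) i j k, 0 ≤ (q : ℍ).re)
    (him : ∀ x ∈ I, ∀ k : Fin d, k ≠ i → k ≠ j →
      ∀ q ∈ cubeFaces U x i j k ++ cubeFaces U (x - Pi.single k 1) i j k, ‖(q : ℍ).im‖ ≤ m)
    (hmin : ∀ x ∈ I, ∀ V : (Metric.sphere (0 : ℍ) 1),
      actionThrough U x i ≤ actionThrough (Function.update U (x, i) V) x i ∧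
      actionThrough U x j ≤ actionThrough (Function.update U (x, j) V) x j ∧
      actionThrough U (x + Pi.single j 1) i ≤ actionThrough (Function.update U (x + Pi.single j 1, i) V) (x + Pi.single j 1) i ∧
      actionThrough U (x + Pi.single i 1) j ≤ actionThrough (Function.update U (x + Pi.single i 1, j) V) (x + Pi.single i 1) j)
    (hM : ∀ y ∈ layer I, ‖curv U y i j‖ ≤ M) {x₀ : Site d} (hx₀ : x₀ ∈ I)
    (hD : ∀ y ∈ layer I, distSq x₀ y ≤ D2) :
    ‖curv U x₀ i j‖ ≤ M + (232 * ((d : ℝ) - 2) * m ^ 2) / (2 * d) * D2 := by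
  refine sineCurvature_le_layerMax hd U i j hij I hm hm2 hre him (fun x hx => ?_) hM hx₀ hD
  exact ⟨(covDiv_eq_zero_of_forall_actionThrough_le U x i fun V => (hmin x hx V).1).1,
    (covDiv_eq_zero_of_forall_actionThrough_le U x j fun V => (hmin x hx V).2.1).1,
    (covDiv_eq_zero_of_forall_actionThrough_le U _ i fun V => (hmin x hx V).2.2.1).1,
    (covDiv_eq_zero_of_forall_actionThrough_le U _ j fun V => (hmin x hx V).2.2.2).1⟩

end

end Summit.QuantumFields.BalabanUV.T4Continuum.NE7b.MinimiserMaximumPrinciple
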